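import Summits.FinalStateConjecture.FinalStateConjecture.Theorems.EIHFluxBalanceInertialRecessionStubRechart3OtherHoles
import Summits.FinalStateConjecture.FinalStateConjecture.Theorems.EIHFluxBalanceInertialRecessionFlatPackageProfile
import Summits.FinalStateConjecture.FinalStateConjecture.Theorems.EIHFluxBalanceInertialRecessionFlatChart

/-!
# Route EIHFluxBalance — `InertialRecession`, re-charting: the radiation-zone package for every spin

Helper file for the crux `stmt-FinalStateConjecture-10166`
(`Summit.FinalStateConjecture.FinalStateConjecture.Theses.EIHFluxBalance.InertialRecession`),
line `sublinear-is-free-clean-window-charges`, stub `stub_rechart` (the transfer P2), part G1.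

Route seat 1's flat package `flat_radiationZone_package_of_profile'` (`…FlatPackageProfile`) assumes
Schwarzschild holes (`aᵢ = 0`) only to obtain bounded derivatives of the inverse painted frames (via
`Λᵢ ↦ boost(vᵢ)`, Schwarzschild isotropy). With the NORMALISED frames `Λ̃ᵢ` of `…StubRechart3Frames`
(same painted field and radii, decaying derivatives) the general theorem
`tendsto_deviationCk_flat_of_ansatz'` (`…FlatChart`) applies for every spin:
`tendsto_deviationCk_flat_of_ansatz_normalised`; the package `flat_radiationZone_package_general`
follows with the tubes measured by `Kerr.radius aᵢ` (rest radius `≥` lab distance `− |aᵢ|`).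
[folklore]
-/

noncomputable section

set_option linter.dupNamespace false

open Set Filter Function Metric Topology TopologicalSpace
open scoped ContDiff Manifold ENNReal BigOperators
open Literature.Geometry.Lorentzian

namespace Summit.FinalStateConjecture.FinalStateConjecture.Theorems.SublinearIsFree.Rechart

/-- **Flat convergence for every spin, via normalised frames.** [folklore] -/
theorem tendsto_deviationCk_flat_of_ansatz_normalised (𝓢 : Spacetime 4) {N : ℕ} (M a : Fin N → ℝ)
    (Λ Λt : Fin N → ℝ → lorentzGroup) (ξ : Fin N → ℝ → E3) (U : Opens E4) (Φ : U → 𝓢.carrier)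
    (hΦ : ContMDiff 𝓘(ℝ, E4) (𝓡 4) ∞ Φ)
    (hdev : Tendsto (fun t ↦ 𝓢.deviationCk ⟨U, fun x ↦ Minkowski.bilin +
      ∑ i, (boostedKerrBilin (Λ i (x 0)) (E4.ofTimeSpace (x 0) (ξ i (x 0))) (M i) (a i) x -
        Minkowski.bilin), fun x ↦ x 0, E4.spatialNorm⟩ Φ 2 t) atTop (𝓝 0))
    (hbil : ∀ j t x, boostedKerrBilin (Λt j t) (E4.ofTimeSpace t (ξ j t)) (M j) (a j) x =
      boostedKerrBilin (Λ j t) (E4.ofTimeSpace t (ξ j t)) (M j) (a j) x)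
    (hΛt : ∀ j, ContDiff ℝ ∞ (fun t ↦ ((Λt j t : E4 ≃L[ℝ] E4) : E4 →L[ℝ] E4)))
    (hdec : ∀ j m, 1 ≤ m → m ≤ 3 → Tendsto (fun t ↦ iteratedDeriv m
      (fun s ↦ ((Λt j s : E4 ≃L[ℝ] E4) : E4 →L[ℝ] E4)) t) atTop (𝓝 0))
    {γ : ℝ} (hγ1 : 1 ≤ γ) (huγ : ∀ j t, |((Λt j t : E4 ≃L[ℝ] E4) (E4.basisVector 0)) 0| ≤ γ)
    (hpos : ∀ j t, 0 < ((Λt j t : E4 ≃L[ℝ] E4) (E4.basisVector 0)) 0)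
    (hξ : ∀ j, ContDiff ℝ ∞ (ξ j))
    (hmis : ∀ j, ∀ m : ℕ, m ≤ 2 → Tendsto (fun t ↦ iteratedDeriv m (fun s ↦ deriv (ξ j) s -
      ((((Λt j s : E4 ≃L[ℝ] E4) (E4.basisVector 0)) 0)⁻¹ •
        E4.spatial ((Λt j s : E4 ≃L[ℝ] E4) (E4.basisVector 0)))) t) atTop (𝓝 0))
    {R' : ℝ → ℝ} (hR : Tendsto R' atTop atTop) {U₀ : Opens E4} (hU₀ : U₀ ≤ U)
    (hfar : ∀ z ∈ U₀, ∀ i, R' (z 0) < ‖E4.spatial z - ξ i (z 0)‖) :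
    Tendsto (fun t ↦ 𝓢.deviationCk (Minkowski.backgroundOn U₀) (Φ ∘ Opens.inclusion hU₀) 2 t)
      atTop (𝓝 0) := by
  -- the reference fields agree
  have hsum : (fun x : E4 ↦ Minkowski.bilin +
      ∑ i, (boostedKerrBilin (Λ i (x 0)) (E4.ofTimeSpace (x 0) (ξ i (x 0))) (M i) (a i) x -
        Minkowski.bilin)) = fun x ↦ Minkowski.bilin +
      ∑ i, (boostedKerrBilin (Λt i (x 0)) (E4.ofTimeSpace (x 0) (ξ i (x 0))) (M i) (a i) x -
        Minkowski.bilin) := by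
    funext x
    congr 1
    exact Finset.sum_congr rfl fun i _ ↦ by rw [hbil]
  have hdev' : Tendsto (fun t ↦ 𝓢.deviationCk ⟨U, fun x ↦ Minkowski.bilin +
      ∑ i, (boostedKerrBilin (Λt i (x 0)) (E4.ofTimeSpace (x 0) (ξ i (x 0))) (M i) (a i) x -
        Minkowski.bilin), fun x ↦ x 0, E4.spatialNorm⟩ Φ 2 t) atTop (𝓝 0) :=
    hdev.congr fun t ↦ deviationCk_mk_congr 𝓢 U hsum _ _ Φ 2 t
  -- uniform bounds on the inverse frames and the centres after some lab time
  set Γ : ℝ := 4 * γ + 2 with hΓ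
  have hΓ1 : 1 ≤ Γ := by rw [hΓ]; linarith
  have hwin : ∀ j, ∃ S : ℝ, ∀ t, S ≤ t →
      (∀ m ≤ 2, ‖iteratedDeriv m (fun s ↦ (((Λt j s : E4 ≃L[ℝ] E4).symm : E4 ≃L[ℝ] E4) : E4 →L[ℝ] E4)) t‖ ≤ Γ) ∧
      (∀ m, 1 ≤ m → m ≤ 2 → ‖iteratedDeriv m (ξ j) t‖ ≤ Γ) := by
    intro j
    obtain ⟨S, -, -, -, -, -, -, -, -, hc', hc'', -, hF', hF''⟩ :=
      exists_window (Λt j) (ξ j) (hΛt j) (hdec j) (huγ j) (hpos j) (hξ j) (hmis j) one_pos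
    refine ⟨S, fun t ht ↦ ⟨fun m hm ↦ ?_, fun m hm1 hm2 ↦ ?_⟩⟩
    · interval_cases m
      · rw [iteratedDeriv_zero]
        have := norm_lorentz_symm_le_four_mul (Λt j) (huγ j) t
        rw [hΓ]; linarith
      · rw [iteratedDeriv_one]; exact (hF' t ht).trans (by rw [hΓ]; linarith)
      · exact (hF'' t ht).trans (by rw [hΓ]; linarith)
    · refine (norm_iteratedDeriv_le_centrePath (hξ j) m t).trans ?_
      interval_cases m
      · rw [iteratedDeriv_one]
        have h1 : ‖deriv (centrePath (ξ j)) t‖ ≤ ‖deriv (centrePath (ξ j)) t - normVel (Λt j t)‖ +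
            ‖normVel (Λt j t)‖ := norm_le_norm_sub_add _ _
        have h2 : ‖normVel (Λt j t)‖ ≤ 4 * γ := (norm_normVel_le _).trans (norm_frame_le_four_mul (Λt j) (huγ j) t)
        have h3 := hc' t ht
        rw [hΓ]; linarith
      · exact (hc'' t ht).trans (by rw [hΓ]; linarith)
  choose S hS using hwin
  set T₀ : ℝ := ∑ j, |S j| with hT₀
  have hT₀S : ∀ j, S j ≤ T₀ := fun j ↦ (le_abs_self _).trans
    (Finset.single_le_sum (f := fun j ↦ |S j|) (fun _ _ ↦ abs_nonneg _) (Finset.mem_univ j))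
  exact tendsto_deviationCk_flat_of_ansatz' 𝓢 M a Λt ξ U Φ hΦ hdev' (fun j ↦ contDiff_lorentz_symm (Λt j) (hΛt j))
    hξ hΓ1 (fun j t ht m hm ↦ ((hS j t ((hT₀S j).trans ht)).1 m hm))
    (fun j t ht m hm1 hm2 ↦ ((hS j t ((hT₀S j).trans ht)).2 m hm1 hm2)) hR hU₀ hfar

/-- **The radiation-zone package for every spin.** General-spin form of
`flat_radiationZone_package_of_profile'`: from the crux's lab chart and its `C²` deviation decay, the
normalised painted frames, Cesàro velocities `ξᵢ(t)/t → Vᵢ` (`‖Vᵢ‖ < 1`) and a prescribed continuous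
sublinear profile `R' → ∞`, `R' ≥ 1 + Σ|rinᵢ| + Σ|aᵢ|`: the hole-following far domain `U₀ ≤ U`, the flat
chart `Φ ∘ inclusion` (open embedding of the late region, `C²`-convergent to `η` on whole slabs) and
SUBLINEAR excision radii `ρᵢ` whose straight tubes `{r_{aᵢ}(boost(Vᵢ)⁻¹ x) ≤ ρᵢ(x⁰)}` cover the
complement of `U₀` in the late half-space. [folklore] -/
theorem flat_radiationZone_package_general (𝓢 : Spacetime 4) {N : ℕ} (M a rin : Fin N → ℝ)
    (Λ Λt : Fin N → ℝ → lorentzGroup) (ξ : Fin N → ℝ → E3) (τ₀ : ℝ) (U : Opens E4)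
    (Φ : U → 𝓢.carrier) (hΦ : ContMDiff 𝓘(ℝ, E4) (𝓡 4) ∞ Φ)
    (hU : {x : E4 | τ₀ < x 0 ∧ ∀ i, rin i < Kerr.radius (a i) (poincareInv (Λ i (x 0))
      (E4.ofTimeSpace (x 0) (ξ i (x 0))) x)} ⊆ (U : Set E4))
    (hemb : IsOpenEmbedding (((⟨U, fun x ↦ Minkowski.bilin +
      ∑ i, (boostedKerrBilin (Λ i (x 0)) (E4.ofTimeSpace (x 0) (ξ i (x 0))) (M i) (a i) x -
        Minkowski.bilin), fun x ↦ x 0, E4.spatialNorm⟩ : ModelBackground).lateRegion τ₀).restrict Φ))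
    (hdev : Tendsto (fun t ↦ 𝓢.deviationCk ⟨U, fun x ↦ Minkowski.bilin +
      ∑ i, (boostedKerrBilin (Λ i (x 0)) (E4.ofTimeSpace (x 0) (ξ i (x 0))) (M i) (a i) x -
        Minkowski.bilin), fun x ↦ x 0, E4.spatialNorm⟩ Φ 2 t) atTop (𝓝 0))
    (hbil : ∀ j t x, boostedKerrBilin (Λt j t) (E4.ofTimeSpace t (ξ j t)) (M j) (a j) x =
      boostedKerrBilin (Λ j t) (E4.ofTimeSpace t (ξ j t)) (M j) (a j) x)
    (hΛt : ∀ j, ContDiff ℝ ∞ (fun t ↦ ((Λt j t : E4 ≃L[ℝ] E4) : E4 →L[ℝ] E4)))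
    (hdec : ∀ j m, 1 ≤ m → m ≤ 3 → Tendsto (fun t ↦ iteratedDeriv m
      (fun s ↦ ((Λt j s : E4 ≃L[ℝ] E4) : E4 →L[ℝ] E4)) t) atTop (𝓝 0))
    {γ : ℝ} (hγ1 : 1 ≤ γ) (huγ : ∀ j t, |((Λt j t : E4 ≃L[ℝ] E4) (E4.basisVector 0)) 0| ≤ γ)
    (hpos : ∀ j t, 0 < ((Λt j t : E4 ≃L[ℝ] E4) (E4.basisVector 0)) 0)
    (hξ : ∀ j, ContDiff ℝ ∞ (ξ j))
    (hmis : ∀ j, ∀ m : ℕ, m ≤ 2 → Tendsto (fun t ↦ iteratedDeriv m (fun s ↦ deriv (ξ j) s -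
      ((((Λt j s : E4 ≃L[ℝ] E4) (E4.basisVector 0)) 0)⁻¹ •
        E4.spatial ((Λt j s : E4 ≃L[ℝ] E4) (E4.basisVector 0)))) t) atTop (𝓝 0))
    (V : Fin N → E3) (hV1 : ∀ i, ‖V i‖ < 1)
    (hV : ∀ i, Tendsto (fun t : ℝ ↦ t⁻¹ • ξ i t) atTop (𝓝 (V i))) {R' : ℝ → ℝ}
    (hR'c : Continuous R') (hR'R₀ : ∀ t, 1 + ∑ i, |rin i| + ∑ i, |a i| ≤ R' t) (hR'top : Tendsto R' atTop atTop)
    (hR'div : Tendsto (fun t ↦ R' t / t) atTop (𝓝 0)) :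
    ∃ (U₀ : Opens E4) (hU₀ : U₀ ≤ U) (ρ : Fin N → ℝ → ℝ),
      (U₀ : Set E4) = {x : E4 | max τ₀ 0 + 1 < x 0 ∧ ∀ i, R' (x 0) < ‖E4.spatial x - ξ i (x 0)‖} ∧
      (∀ i, Tendsto (fun t ↦ ρ i t / t) atTop (𝓝 0)) ∧
      {x : E4 | max τ₀ 0 + 1 < x 0 ∧ ∀ i, ρ i (x 0) <
        Kerr.radius (a i) (poincareInv (Lorentz.boost (V i) (hV1 i)) 0 x)} ⊆ (U₀ : Set E4) ∧
      Tendsto (fun t ↦ 𝓢.deviationCk (Minkowski.backgroundOn U₀) (Φ ∘ Opens.inclusion hU₀) 2 t)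
        atTop (𝓝 0) ∧
      IsOpenEmbedding (((Minkowski.backgroundOn U₀).lateRegion (max τ₀ 0 + 1)).restrict
        (Φ ∘ Opens.inclusion hU₀)) := by
  -- the far-distance function and the domain
  set R₀ : ℝ := 1 + ∑ i, |rin i| + ∑ i, |a i| with hR₀
  have hR₀i : ∀ i, rin i + |a i| < R₀ := fun i ↦ by
    have h1 : |rin i| ≤ ∑ j, |rin j| :=
      Finset.single_le_sum (f := fun j ↦ |rin j|) (fun _ _ ↦ abs_nonneg _) (Finset.mem_univ i)
    have h2 : |a i| ≤ ∑ j, |a j| :=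
      Finset.single_le_sum (f := fun j ↦ |a j|) (fun _ _ ↦ abs_nonneg _) (Finset.mem_univ i)
    linarith [le_abs_self (rin i)]
  have hR'R₀' : ∀ t, R₀ ≤ R' t := fun t ↦ by rw [hR₀]; exact hR'R₀ t
  -- the start time and the hole-following far domain
  set τ₁ : ℝ := max τ₀ 0 + 1 with hτ₁
  have hτ₀₁ : τ₀ ≤ τ₁ := (le_max_left τ₀ 0).trans (le_add_of_nonneg_right zero_le_one)
  have hc0 : Continuous fun y : E4 ↦ y 0 := PiLp.continuous_apply 2 _ 0
  have hopen : IsOpen {x : E4 | τ₁ < x 0 ∧ ∀ i, R' (x 0) < ‖E4.spatial x - ξ i (x 0)‖} := by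
    have h1 : IsOpen {x : E4 | τ₁ < x 0} := isOpen_lt continuous_const hc0
    have h2 : IsOpen (⋂ i, {x : E4 | R' (x 0) < ‖E4.spatial x - ξ i (x 0)‖}) :=
      isOpen_iInter_of_finite fun i ↦ isOpen_lt (hR'c.comp hc0)
        (continuous_norm.comp (E4.spatial.continuous.sub ((hξ i).continuous.comp hc0)))
    have h3 : {x : E4 | τ₁ < x 0 ∧ ∀ i, R' (x 0) < ‖E4.spatial x - ξ i (x 0)‖} =
        {x : E4 | τ₁ < x 0} ∩ ⋂ i, {x : E4 | R' (x 0) < ‖E4.spatial x - ξ i (x 0)‖} := by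
      ext x
      simp
    rw [h3]
    exact h1.inter h2
  let U₀ : Opens E4 := ⟨{x : E4 | τ₁ < x 0 ∧ ∀ i, R' (x 0) < ‖E4.spatial x - ξ i (x 0)‖}, hopen⟩
  -- `U₀ ≤ U` (rest radius ≥ lab distance − |a|)
  have hU₀ : U₀ ≤ U := by
    intro x hx
    have hx' : τ₁ < x 0 ∧ ∀ i, R' (x 0) < ‖E4.spatial x - ξ i (x 0)‖ := hx
    refine hU ⟨lt_of_le_of_lt hτ₀₁ hx'.1, fun i ↦ ?_⟩
    have h1 := sub_abs_le_radius_poincareInv (Λ i (x 0)) (a i) (x := x) rfl (ξ i (x 0))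
    have h2 := hx'.2 i
    have h3 := hR'R₀' (x 0)
    have h4 := hR₀i i
    linarith
  -- the excision radii
  set ρ : Fin N → ℝ → ℝ := fun i t ↦
    (1 + 3 * |((Lorentz.boost (V i) (hV1 i) : E4 ≃L[ℝ] E4) (E4.basisVector 0)) 0|) *
      (R' t + ‖ξ i t - t • V i‖) + 1 with hρ
  refine ⟨U₀, hU₀, ρ, rfl, fun i ↦ ?_, ?_, ?_, ?_⟩
  · -- sublinearity
    have hdrift : Tendsto (fun t ↦ ‖ξ i t - t • V i‖ / t) atTop (𝓝 0) := by
      have h := tendsto_drift_div_of_cesaro (hV i) 0 0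
      refine h.congr fun t ↦ ?_
      rw [zero_add, sub_zero]
    have h1 := tendsto_excisionRadius_div
      (1 + 3 * |((Lorentz.boost (V i) (hV1 i) : E4 ≃L[ℝ] E4) (E4.basisVector 0)) 0|) hR'div hdrift
    have h2 : Tendsto (fun t : ℝ ↦ (1 : ℝ) / t) atTop (𝓝 0) := tendsto_const_nhds.div_atTop tendsto_id
    have h3 := h1.add h2
    rw [add_zero] at h3
    refine h3.congr fun t ↦ ?_
    change _ = ((1 + 3 * |((Lorentz.boost (V i) (hV1 i) : E4 ≃L[ℝ] E4) (E4.basisVector 0)) 0|) *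
      (R' t + ‖ξ i t - t • V i‖) + 1) / t
    rw [add_div]
  · -- containment of the complement of the straight tubes
    rintro x ⟨hx1, hx2⟩
    refine ⟨hx1, fun i ↦ ?_⟩
    by_contra hle
    have hle' : ‖E4.spatial x - ξ i (x 0)‖ ≤ R' (x 0) := not_lt.mp hle
    have h := radius_poincareInv_le_of_near_centre' (Lorentz.boost (V i) (hV1 i)) 0 (a i) (ξ i) R' hle'
    rw [boostVelocity_boost (hV1 i), map_zero, zero_add] at h
    have h0 : (0 : E4) 0 = 0 := rfl
    rw [h0, sub_zero] at h
    have h2 := hx2 i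
    change (1 + 3 * |((Lorentz.boost (V i) (hV1 i) : E4 ≃L[ℝ] E4) (E4.basisVector 0)) 0|) *
      (R' (x 0) + ‖ξ i (x 0) - x 0 • V i‖) + 1 < _ at h2
    linarith
  · -- flat convergence (normalised frames)
    exact tendsto_deviationCk_flat_of_ansatz_normalised 𝓢 M a Λ Λt ξ U Φ hΦ hdev hbil hΛt hdec hγ1 huγ hpos hξ
      hmis hR'top hU₀ fun z hz i ↦ hz.2 i
  · -- open embedding of the later, smaller late region
    exact isOpenEmbedding_restrict_lateRegion_of_le' (M := 𝓢.carrier) ⟨U, fun x ↦ Minkowski.bilin +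
      ∑ i, (boostedKerrBilin (Λ i (x 0)) (E4.ofTimeSpace (x 0) (ξ i (x 0))) (M i) (a i) x -
        Minkowski.bilin), fun x ↦ x 0, E4.spatialNorm⟩ (fun _ ↦ rfl) hemb hU₀ hτ₀₁

/-- Registered one-line form (worker carrier `rechart_sum_abs_dominates`). [folklore] -/
theorem rechart_sum_abs_dominates : ∀ {N : ℕ} (rin a : Fin N → ℝ) (i : Fin N), rin i + |a i| < 1 + ∑ j, |rin j| + ∑ j, |a j| := by
  intro N rin a i
  have h1 : |rin i| ≤ ∑ j, |rin j| :=
    Finset.single_le_sum (f := fun j ↦ |rin j|) (fun _ _ ↦ abs_nonneg _) (Finset.mem_univ i)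
  have h2 : |a i| ≤ ∑ j, |a j| :=
    Finset.single_le_sum (f := fun j ↦ |a j|) (fun _ _ ↦ abs_nonneg _) (Finset.mem_univ i)
  linarith [le_abs_self (rin i)]

end Summit.FinalStateConjecture.FinalStateConjecture.Theorems.SublinearIsFree.Rechart

end
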